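import Literature.MathematicalPhysics.QuantumFieldTheory.Balaban1983to89.B8Prop7PrintedRZdGF3P2HalfSpaceAllL

/-!
# `Balaban1983to89.B8Ineq145LineageCStar` — r05's CROSSING-BOND WITNESS AGAINST THE PRINTED CONSTANT OF [Balaban1985RegularSpaces] (1.145) (cell GAPS G-B8-01), RE-RUN INSIDE
# AN ARBITRARY NONTRIVIAL C⋆-ALGEBRA `𝔸`: the flat abelian data `U₀ = 1`, `U₁ ≡ e^{iθ}·1` (the CENTRAL scalar unit `expUnit (algebraMap ℂ 𝔸 (iθ))`) give, on every level-1 bond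
# crossing `∂Λ₁`, `|(U′U₀)‾¹_b − Ū₀¹_b| = 2|sin(flatRatio(d,L)·Lθ∕2)|` (any `d`, `L`), hence `> 2α₂` at `Lθ = (27∕28)α₂`, `d = 4`, every `L ≥ 3`

statement-level skeleton of published theorems with citation tags; proofs where landed; nothing here is a claim about the Yang–Mills mass gap

T. Bałaban, *Spaces of regular gauge field configurations on a lattice and gauge fixing conditions*, Commun. Math. Phys. **99** (1985) 75–102 `[Balaban1985RegularSpaces]`
("B8"): Prop. 7 (1.145) p. 100, (1.29)–(1.31) pp. 81–82; T. Bałaban, *Averaging operations for lattice gauge theories*, Commun. Math. Phys. **98** (1985) 17–51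
`[Balaban1985Averaging]` ([3]): (21) p. 21, (42)–(43) pp. 23–24, (69) p. 29, (82) p. 30, (89)–(90) p. 31, (110) p. 34.

## WHY THIS FILE (cell `pub-ymgap`, HUMAN RULING D-0062 ∕ D-0149 ∕ D-0154; N05 = [B8]; width seat `pub-ymgap-dag-n05-w5` g2, piece (B) of its CLAIM-1, bus 2026-08-28T06:12Z ∕ 06:36Z)

`B8Ineq145Lineage` (r05) computes both members of (1.145) for the flat abelian witness in the coefficient algebra `ℂ`; its §1 (`hol_cst`, `bavg_cst`, `avgIter_cst`), §3 (`u8`) and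
§4 (`tildIter_u8_crossing` ∕ `avgIter_u8_crossing`: «every background, every `U₁`, no smallness, no commutativity») are ALREADY stated for an arbitrary complete normed `ℂ`-algebra;
only §2 ∕ §5 («Scalar ∕ Witness»: `mlog_eI`, `Favg_cst`, `vframe_cst`, `dbavg_cst`, `dbavgIter_cst`, `tildIter_crossing_cst`, `norm_lhs145_crossing`) fix `𝔸 = ℂ`.  NODE 00's records
carry a GENERAL coefficient C⋆-algebra `θ.𝔸` (print: `M_N(ℂ)`), and the record-keyed P₇-currency certificate (`B8Prop7PrintedRZdGF3P2HalfSpaceCStar`, next file) needs the witness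
INSIDE `θ.𝔸`.  THIS FILE re-runs r05's §2 ∕ §5 for the central scalar unit `c = e^{iθ}·1` of any nontrivial C⋆-algebra — no functorial transport of the averaging operations is
needed: the series logarithm of `cⁿ` is `inθ·1` (`B7BlockAvgLog.mlog_exp`; `‖iφ·1‖ = |φ|` by `norm_algebraMap'`), the constant block frames are central and cancel
(`Algebra.commute_algebraMap_left`), `‖c − 1‖ = 2|sin(θ∕2)|` (`NormedSpace.algebraMap_exp_comm`), and the `d = 4` arithmetic is g0's `flat_witness_exceeds_allL` BY NAME.

## WHAT IS PROVED (kernel, 0 sorry; theorems only; any nontrivial C⋆-algebra `𝔸`)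

`norm_algebraMap_I_mul` · `expUnit_algebraMap_pow` · `expUnit_algebraMap_mul` · `mlog_expUnit_algebraMap` ((21) of [3] on `e^{iφ}·1`, `|φ| < ln 2`) · `norm_expUnit_algebraMap_sub_one` ·
`real_smul_algebraMap` · `Favg_cst_algebraMap` ((110): `F ≡ iθ·d(L−1)∕2·1`, `d(L−1)|θ| < ln 2`) · `vframe_cst_algebraMap` ((82)) · `dbavgIter_one_cst_algebraMap` ((90): `U̿₁¹ ≡ e^{iLθ}·1`) ·
★ `tildIter_crossing_cst_algebraMap` (`Ũ′¹_b = e^{i·flatRatio(d,L)·Lθ}·1` on the crossing bond, print's gauge `u8`) · ★ `norm_lhs145_crossing_algebraMap` (the left member of (1.145)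
there `= 2|sin(flatRatio(d,L)·Lθ∕2)|`, any `d`, `L ≥ 1`) · ★★ `ineq145_fails_algebraMap_allL` (`d = 4`, every `L ≥ 3`, `Lθ = (27∕28)α₂`, `0 < α₂ ≤ 1∕6`: `2α₂ <` that member).

## HONEST SCOPE

Closed-form evaluation of r05's witness in a general coefficient algebra — the arithmetic core of a NEGATIVE certificate about a proof CURRENCY (the printed constant `2α₂` of
(1.145)); NO estimate of [Balaban1985RegularSpaces] is proved or denied; the repaired currency `B8Ineq145.Prop7RepairedC` is untouched.  Count-neutral helper keyed
`stmt-QuantumFields-20542` (K1⁷); N05 NOT discharged; no count claim; one finite `𝕋⁴` programme at fixed `ε`, Bałaban AS PRINTED; the Yang–Mills mass gap (Clay) is NOT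
proved by any of this — R4 closes the conditional finite-`𝕋⁴` rung `BalabanLadder.UV` only; nothing continuum ∕ ℝ⁴ ∕ OS.  No `sorry`, no `def`, no `instance`, no `notation`.
Unit `pub-ymgap-dag-n05-w5` (g2), 2026-08-28.

RELATED, NOT DUPLICATED: `B8Ineq145Lineage` (the `ℂ` case, USED for its `𝔸`-general §§1,3,4), `B8Prop7PrintedRZdGF3P2HalfSpaceAllL` (g0: `flat_witness_exceeds_allL` USED; its
`ineq145_fails_lineage_allL` is the `ℂ` instance of `ineq145_fails_algebraMap_allL`), `B7BlockAvgLog` (`mlog_exp`), `B7Prop3Flat` ∕ `B7Prop4Flat` ∕ `B7Eq92Concrete` (the letters).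

[cite: Balaban1985RegularSpaces, Prop. 7 (1.145) p.100, (1.29)–(1.31) pp.81–82; Balaban1985Averaging, (21) p.21, (42)–(43) pp.23–24, (69) p.29, (82) p.30, (89)–(90) p.31, (110) p.34]
-/

noncomputable section

open NormedSpace Finset

namespace Literature.MathematicalPhysics.QuantumFieldTheory.Balaban1983to89.B8Ineq145LineageCStar

open Complex (I)
open B7Prop1Explicit B7Prop1Local B7Prop2Explicit B7Eq92Concrete B7Eq84Concrete
open MatrixLog (mlog)
open B7BlockAvgLog (mlog_exp)
open B7Prop3Flat (Favg vframe dbavg)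
open B7Prop4Flat (dbavgIter dbavgIter_succ dbavgIter_zero)
open B8Ineq145 (stairMean stairMean_eq flatRatio flat_log_identity)
open B8Ineq145Lineage (u8 hol_cst zc_treeWord_boxVec nbox sum_nbox_eq_stairMean bavg_cst tildIter_u8_crossing avgIter_u8_crossing)
open B8Prop7PrintedRZdGF3P2HalfSpaceAllL (flat_witness_exceeds_allL)

-- `Site` alone could resolve to the torus sites of `Setup.lean`; re-export the `ℤ^d` sites of `B7Prop1Explicit`.
export B7Prop1Explicit (Site)

variable {d : ℕ} {𝔸 : Type} [CStarAlgebra 𝔸] [Nontrivial 𝔸]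

/-! ## §1 The flat abelian witness inside a general coefficient C⋆-algebra: the central scalar unit `U₁ ≡ e^{iθ}·1` -/

/-- `‖iφ·1‖ = |φ|` in a nontrivial C⋆-algebra. [folklore] -/
private theorem norm_algebraMap_I_mul (φ : ℝ) : ‖algebraMap ℂ 𝔸 (I * (φ : ℂ))‖ = |φ| := by
  rw [norm_algebraMap', norm_mul, Complex.norm_I, one_mul, Complex.norm_real, Real.norm_eq_abs]

omit [Nontrivial 𝔸] in
/-- Powers of the central unit `e^{iθ}·1`: `(e^{iθ}·1)ⁿ = e^{inθ}·1`. [folklore] -/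
private theorem expUnit_algebraMap_pow (θ : ℝ) (n : ℕ) :
    (expUnit (algebraMap ℂ 𝔸 (I * (θ : ℂ)))) ^ n = expUnit (algebraMap ℂ 𝔸 (I * (((n : ℝ) * θ : ℝ) : ℂ))) := by
  letI : NormedAlgebra ℚ 𝔸 := NormedAlgebra.restrictScalars ℚ ℂ 𝔸
  apply Units.ext
  have h : (n : ℂ) * (I * (θ : ℂ)) = I * (((n : ℝ) * θ : ℝ) : ℂ) := by push_cast; ring
  rw [Units.val_pow_eq_pow_val, val_expUnit, val_expUnit, ← exp_nsmul, nsmul_eq_mul, ← map_natCast (algebraMap ℂ 𝔸) n,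
    ← map_mul, h]

omit [Nontrivial 𝔸] in
/-- Products of central units: `e^{ia}·1 · e^{ib}·1 = e^{i(a+b)}·1`. [folklore] -/
private theorem expUnit_algebraMap_mul (a b : ℝ) :
    expUnit (algebraMap ℂ 𝔸 (I * (a : ℂ))) * expUnit (algebraMap ℂ 𝔸 (I * (b : ℂ)))
      = expUnit (algebraMap ℂ 𝔸 (I * ((a + b : ℝ) : ℂ))) := by
  letI : NormedAlgebra ℚ 𝔸 := NormedAlgebra.restrictScalars ℚ ℂ 𝔸
  apply Units.ext
  have h : I * (a : ℂ) + I * (b : ℂ) = I * ((a + b : ℝ) : ℂ) := by push_cast; ring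
  rw [Units.val_mul, val_expUnit, val_expUnit, val_expUnit,
    ← exp_add_of_commute (Algebra.commute_algebraMap_left _ _), ← map_add, h]

/-- The series logarithm (21) of [3] of `e^{iφ}·1` is `iφ·1` for `|φ| < ln 2` (`B7BlockAvgLog.mlog_exp`). [cite: Balaban1985Averaging, (21) p.21] -/
theorem mlog_expUnit_algebraMap (φ : ℝ) (hφ : |φ| < Real.log 2) :
    mlog ((expUnit (algebraMap ℂ 𝔸 (I * (φ : ℂ))) : 𝔸ˣ) : 𝔸) = algebraMap ℂ 𝔸 (I * (φ : ℂ)) := by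
  rw [val_expUnit]
  exact mlog_exp (by rw [norm_algebraMap_I_mul]; exact hφ)

/-- `|e^{iφ}·1 − 1| = 2|sin(φ/2)|`. [folklore] -/
private theorem norm_expUnit_algebraMap_sub_one (φ : ℝ) :
    ‖((expUnit (algebraMap ℂ 𝔸 (I * (φ : ℂ))) : 𝔸ˣ) : 𝔸) - 1‖ = 2 * |Real.sin (φ / 2)| := by
  rw [val_expUnit, ← algebraMap_exp_comm, ← map_one (algebraMap ℂ 𝔸), ← map_sub, norm_algebraMap',
    ← Complex.exp_eq_exp_ℂ, Complex.norm_exp_I_mul_ofReal_sub_one, Real.norm_eq_abs, abs_mul, abs_two]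

omit [Nontrivial 𝔸] in
/-- Real scalars act through `algebraMap`: `r • (z·1) = (rz)·1`. [folklore] -/
private theorem real_smul_algebraMap (r : ℝ) (z : ℂ) : r • algebraMap ℂ 𝔸 z = algebraMap ℂ 𝔸 ((r : ℂ) * z) := by
  rw [← Complex.coe_smul, Algebra.smul_def, map_mul]

variable (L : ℕ)

/-- `Σ_κ r_κ ≤ d(L − 1)`. [folklore] -/
private theorem nbox_le (r : Fin d → Fin L) : nbox L r ≤ d * (L - 1) := by
  unfold nbox
  calc ∑ κ, (r κ : ℕ) ≤ ∑ _κ : Fin d, (L - 1) := Finset.sum_le_sum fun κ _ => Nat.le_sub_one_of_lt (r κ).isLt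
    _ = d * (L - 1) := by simp

/-- **The exponent (110) of [3] for `U₁ ≡ e^{iθ}·1` in a general coefficient algebra**: `F(y) = iθ·d(L−1)/2 · 1` (every logarithm is the series
logarithm, `d(L−1)|θ| < ln 2`). [cite: Balaban1985Averaging, (110) p.34, (82) p.30] -/
theorem Favg_cst_algebraMap (θ : ℝ) (hθ : (d : ℝ) * ((L : ℝ) - 1) * |θ| < Real.log 2) (hL : 1 ≤ L) (q : Site d) :
    Favg L (B8Ineq145Lineage.cst (expUnit (algebraMap ℂ 𝔸 (I * (θ : ℂ)))) : Site d → Fin d → 𝔸ˣ) q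
      = algebraMap ℂ 𝔸 (I * ((stairMean d L * θ : ℝ) : ℂ)) := by
  have hterm : ∀ r : Fin d → Fin L,
      mlog ((hol (B8Ineq145Lineage.cst (expUnit (algebraMap ℂ 𝔸 (I * (θ : ℂ)))) : Site d → Fin d → 𝔸ˣ) q
        (treeWord (boxVec L r)) : 𝔸ˣ) : 𝔸) = algebraMap ℂ 𝔸 (I * (((nbox L r : ℝ) * θ : ℝ) : ℂ)) := by
    intro r
    rw [hol_cst, zc_treeWord_boxVec, zpow_natCast, expUnit_algebraMap_pow, mlog_expUnit_algebraMap]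
    rw [abs_mul, Nat.abs_cast]
    have h1 : (nbox L r : ℝ) ≤ (d : ℝ) * ((L : ℝ) - 1) := by
      have h' : ((nbox L r : ℕ) : ℝ) ≤ ((d * (L - 1) : ℕ) : ℝ) := by exact_mod_cast nbox_le L r
      rw [Nat.cast_mul, Nat.cast_sub hL, Nat.cast_one] at h'
      exact h'
    calc (nbox L r : ℝ) * |θ| ≤ (d : ℝ) * ((L : ℝ) - 1) * |θ| := mul_le_mul_of_nonneg_right h1 (abs_nonneg θ)
      _ < Real.log 2 := hθ
  unfold Favg
  simp_rw [hterm, real_smul_algebraMap, ← map_sum]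
  congr 1
  rw [← sum_nbox_eq_stairMean L]
  push_cast
  rw [Finset.sum_mul, Finset.mul_sum]
  exact Finset.sum_congr rfl fun r _ => by ring

/-- **The block frame (82) of `U₁ ≡ e^{iθ}·1` at `U₀ = 1` is the constant central unit `e^{iθ·d(L−1)/2}·1`.** [cite: Balaban1985Averaging, (82) p.30, (110) p.34] -/
theorem vframe_cst_algebraMap (θ : ℝ) (hθ : (d : ℝ) * ((L : ℝ) - 1) * |θ| < Real.log 2) (hL : 1 ≤ L) (q : Site d) :
    vframe L (B8Ineq145Lineage.cst (expUnit (algebraMap ℂ 𝔸 (I * (θ : ℂ)))) : Site d → Fin d → 𝔸ˣ) q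
      = expUnit (algebraMap ℂ 𝔸 (I * ((stairMean d L * θ : ℝ) : ℂ))) := by
  apply Units.ext
  rw [vframe, val_expUnit, Favg_cst_algebraMap L θ hθ hL, val_expUnit]

/-- **(90) at `U₀ = 1`, level 1, on `U₁ ≡ e^{iθ}·1`**: `U̿₁¹ ≡ e^{iLθ}·1` (the constant frames are central and cancel). [cite: Balaban1985Averaging, (89)–(90) p.31, (120) p.35] -/
theorem dbavgIter_one_cst_algebraMap (θ : ℝ) (hθ : (d : ℝ) * ((L : ℝ) - 1) * |θ| < Real.log 2) (hL : 1 ≤ L) (z : Site d) (κ : Fin d) :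
    dbavgIter L (B8Ineq145Lineage.cst (expUnit (algebraMap ℂ 𝔸 (I * (θ : ℂ)))) : Site d → Fin d → 𝔸ˣ) 1 z κ
      = expUnit (algebraMap ℂ 𝔸 (I * (((L : ℝ) * θ : ℝ) : ℂ))) := by
  rw [dbavgIter_succ, dbavgIter_zero, dbavg, bavg_cst, vframe_cst_algebraMap L θ hθ hL, vframe_cst_algebraMap L θ hθ hL,
    B8Ineq145Lineage.cst, expUnit_algebraMap_pow]
  have hc : Commute (expUnit (algebraMap ℂ 𝔸 (I * ((stairMean d L * θ : ℝ) : ℂ))))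
      (expUnit (algebraMap ℂ 𝔸 (I * (((L : ℝ) * θ : ℝ) : ℂ)))) := by
    rw [Commute, SemiconjBy, expUnit_algebraMap_mul, expUnit_algebraMap_mul, add_comm]
  rw [mul_assoc, ← hc.eq, inv_mul_cancel_left]

variable (hL : 1 ≤ L) (i₀ : Fin d)

/-- **`Ũ′¹_b` ON THE CROSSING BOND for `U₁ ≡ e^{iθ}·1`** (any coefficient algebra): `Ũ′¹_b = \overline{R_{0,b₋}U₁}·(U̿₁¹)_b = e^{i·flatRatio(d,L)·Lθ}·1`
— r05's structural identity `tildIter_u8_crossing` (no commutativity, no smallness) with the two constant central factors evaluated.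
[cite: Balaban1985RegularSpaces, (1.30)–(1.31) pp.81–82, (1.145) p.100; Balaban1985Averaging, (82) p.30, (90) p.31] -/
theorem tildIter_crossing_cst_algebraMap (θ : ℝ) (hθ : (d : ℝ) * ((L : ℝ) - 1) * |θ| < Real.log 2) (y : Site d) (hy : y i₀ = -1) :
    tildIter L (1 : Site d → Fin d → 𝔸ˣ)
        (mgauge 1 (u8 L hL i₀ 1 (B8Ineq145Lineage.cst (expUnit (algebraMap ℂ 𝔸 (I * (θ : ℂ))))))
          (B8Ineq145Lineage.cst (expUnit (algebraMap ℂ 𝔸 (I * (θ : ℂ)))))) 1 y i₀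
      = expUnit (algebraMap ℂ 𝔸 (I * ((flatRatio d L * ((L : ℝ) * θ) : ℝ) : ℂ))) := by
  rw [tildIter_u8_crossing L hL i₀ 1 _ y hy, wframe_one_left, dbavgCovIter_one_left,
    vframe_cst_algebraMap L θ hθ hL, dbavgIter_one_cst_algebraMap L θ hθ hL, expUnit_algebraMap_mul,
    B8Ineq145.flat_log_identity d L hL]

/-- **THE LEFT MEMBER OF (1.145) on the crossing bond, any coefficient algebra**: `|(U′U₀)‾¹_b − Ū₀¹_b| = 2|sin(flatRatio(d,L)·Lθ/2)|`
(`U₀ = 1`, `U₁ ≡ e^{iθ}·1`). [cite: Balaban1985RegularSpaces, (1.145) p.100; Balaban1985Averaging, (43) p.24, (69) p.29] -/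
theorem norm_lhs145_crossing_algebraMap (θ : ℝ) (hθ : (d : ℝ) * ((L : ℝ) - 1) * |θ| < Real.log 2) (y : Site d) (hy : y i₀ = -1) :
    ‖((avgIter L (mgauge 1 (u8 L hL i₀ 1 (B8Ineq145Lineage.cst (expUnit (algebraMap ℂ 𝔸 (I * (θ : ℂ))))))
          (B8Ineq145Lineage.cst (expUnit (algebraMap ℂ 𝔸 (I * (θ : ℂ))))) * (1 : Site d → Fin d → 𝔸ˣ)) 1 y i₀ : 𝔸ˣ) : 𝔸)
        - ((avgIter L (1 : Site d → Fin d → 𝔸ˣ) 1 y i₀ : 𝔸ˣ) : 𝔸)‖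
      = 2 * |Real.sin (flatRatio d L * ((L : ℝ) * θ) / 2)| := by
  rw [avgIter_u8_crossing L hL i₀ 1 _ y hy, ← tildIter_u8_crossing L hL i₀ 1 _ y hy,
    tildIter_crossing_cst_algebraMap L hL i₀ θ hθ y hy, avgIter_one, Pi.one_apply, Pi.one_apply, mul_one, Units.val_one,
    norm_expUnit_algebraMap_sub_one]

/-- Bookkeeping of the witness at general `L ≥ 1`: with `Lθ = (27/28)α₂`, `0 < α₂ ≤ 1/6`, every series logarithm used is inside its disc
(`4(L−1)|θ| < ln 2`) and `θ > 0`. [folklore] -/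
private theorem witness_small_allL {L : ℕ} (hL : 1 ≤ L) {α₂ θ : ℝ} (h0 : 0 < α₂) (h1 : α₂ ≤ 1 / 6)
    (hθ : (L : ℝ) * θ = 27 / 28 * α₂) :
    0 < θ ∧ ((4 : ℕ) : ℝ) * (((L : ℕ) : ℝ) - 1) * |θ| < Real.log 2 := by
  have hL' : (1 : ℝ) ≤ L := by exact_mod_cast hL
  have hLpos : (0 : ℝ) < L := by linarith
  have hθpos : 0 < θ := by
    have h' : (L : ℝ) * 0 < (L : ℝ) * θ := by rw [mul_zero, hθ]; positivity
    exact lt_of_mul_lt_mul_left h' hLpos.le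
  have hlog := Real.log_two_gt_d9
  refine ⟨hθpos, ?_⟩
  rw [abs_of_pos hθpos]
  push_cast
  have : (4 : ℝ) * ((L : ℝ) - 1) * θ ≤ 4 * ((L : ℝ) * θ) := by nlinarith
  rw [hθ] at this
  linarith

/-- **THE INEQUALITY OF (1.145) FAILS FOR THE WITNESS IN EVERY COEFFICIENT C⋆-ALGEBRA, AT EVERY `L ≥ 3`** (`d = 4`, `k = 1`, half-space geometry,
`U₀ = 1`, `U₁ ≡ e^{iθ}·1`, `Lθ = (27/28)α₂`, `0 < α₂ ≤ 1/6`): on every crossing bond `b = ⟨y, y + e_{i₀}⟩`, `y_{i₀} = −1`, `2α₂ < |(U′U₀)‾¹_b − Ū₀¹_b|`.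
[cite: Balaban1985RegularSpaces, Prop. 7 (1.145) p.100] -/
theorem ineq145_fails_algebraMap_allL {L : ℕ} (hL3 : 3 ≤ L) (hL : 1 ≤ L) (i₀ : Fin 4) {α₂ θ : ℝ} (h0 : 0 < α₂)
    (h1 : α₂ ≤ 1 / 6) (hθ : (L : ℝ) * θ = 27 / 28 * α₂) (y : Site 4) (hy : y i₀ = -1) :
    2 * α₂ < ‖((avgIter L (mgauge 1 (u8 L hL i₀ 1 (B8Ineq145Lineage.cst (expUnit (algebraMap ℂ 𝔸 (I * (θ : ℂ))))))
          (B8Ineq145Lineage.cst (expUnit (algebraMap ℂ 𝔸 (I * (θ : ℂ))))) * (1 : Site 4 → Fin 4 → 𝔸ˣ)) 1 y i₀ : 𝔸ˣ) : 𝔸)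
        - ((avgIter L (1 : Site 4 → Fin 4 → 𝔸ˣ) 1 y i₀ : 𝔸ˣ) : 𝔸)‖ := by
  obtain ⟨-, h8⟩ := witness_small_allL hL h0 h1 hθ
  rw [norm_lhs145_crossing_algebraMap L hL i₀ θ h8 y hy]
  have hcast : ((L : ℕ) : ℝ) * θ = 27 / 28 * α₂ := hθ
  rw [hcast]
  calc 2 * α₂ < 2 * Real.sin (flatRatio 4 L * (27 / 28 * α₂) / 2) :=
        flat_witness_exceeds_allL L hL3 α₂ h0 (by linarith)
    _ ≤ 2 * |Real.sin (flatRatio 4 L * (27 / 28 * α₂) / 2)| := by gcongr; exact le_abs_self _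

end Literature.MathematicalPhysics.QuantumFieldTheory.Balaban1983to89.B8Ineq145LineageCStar

end
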